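import Summits.Ventures.HodgeKum4.Theorems.KummerFixedLocusL1HilbSeam
import Summits.Ventures.HodgeKum4.Theorems.KummerFixedLocusL1HilbSuperLie
import Summits.Ventures.HodgeKum4.Theorems.KummerFixedLocusL1HilbEvalAux
import Summits.Ventures.HodgeKum4.Theorems.KummerFixedLocusL1HilbJoinPolarWords
import Literature.AlgebraicGeometry.HilbertScheme.HeisenbergMonomialIndependence
import HarnessLib

/-!
# S-F, NUMBER half (p1 g5): stability under the number operators makes a subspace shape-graded

Cell `hodge-kum4`, crux stmt-Ventures-20306 (`LefschetzGenerationHilb5`, W-form), line `v2p5` (p5 g0), last stub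
`stub_span` cut by plan g19's seam `KummerFixedLocusL1HilbSeam` into `SF.NumberHalf` (this file) and `SF.JoinHalf` (p2 g12).

* (the two-point operators kill the vacuum: `L1Hilb.Join.transferTerm_vac`, landed by the JOIN side);
* `transferTerm_id_monomialOp_vac` (N1 on words) — for an even Casimir tensor `C`, `τ_k(id)` acts on a creation monomial
  `𝔮_{r₁}(x_{c₁}) ⋯ 𝔮_{r_m}(x_{c_m})|0⟩` (homogeneous letters, parts `rⱼ ≥ 1`) by the scalar `−k · #{j : rⱼ = k}`: each
  letter of length `k` contributes `−k` (tree letter rule `L1Hilb.transferTerm_superCommute_apply` with `φ = id`, parity `0`,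
  and `IsCasimir`), NO signs and NO normal-ordering constant;
* `twoPt_id_monBasis` (N1) — `τ_k(id)|ₙ` is DIAGONAL in the Nakajima monomial basis `SF.monBasis` with eigenvalue
  `−k · (SF.shapeOf ρ k)`;
* `shapeGraded_of_diag` (N2, generic linear algebra) — a subspace stable under a family of operators simultaneously
  diagonal in a basis, with eigenvalues depending only on a `shape` and separating shapes, contains the shape-isotypic
  pieces of its vectors (Lagrange interpolation, `L1Hilb.mem_of_vandermonde`, refined one operator at a time);
* `numberHalf : SF.NumberHalf` — plan g19's composition (PLAN e9de87e45d37256a, kernel-checked there).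

Kernel-only, standard axioms, no named fact.  HONEST FRAMING: nothing here asserts S-F ∕ L1-Hilb(5) ∕ L1 ∕ HC_Kum4Type ∕ HC.
-/

noncomputable section

open scoped TensorProduct
open DirectSum
open Literature.AlgebraicTopology.SingularHomology
open Literature.AlgebraicGeometry Literature.AlgebraicGeometry.Hyperkaehler Literature.AlgebraicGeometry.HilbertScheme
open Literature.AlgebraicGeometry.Motives (ComplexPoints SchemeOver IsSmoothProjective)

namespace Summit.Ventures.HodgeKum4.L1Hilb.SF

open Summit.Ventures.HodgeKum4.L1Hilb

universe u v w

/-! ### N1 on words (pure algebra over `IsHeisenbergRepresentation`) -/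

section Words

variable {K : Type u} [Field K]
variable {A : ℕ → Type v} [∀ i, AddCommGroup (A i)] [∀ i, Module K (A i)]
variable {Φ : ℕ → ℕ → Type w} [∀ n i, AddCommGroup (Φ n i)] [∀ n i, Module K (Φ n i)]
variable {B : (⨁ i, A i) →ₗ[K] (⨁ i, A i) →ₗ[K] K} {q : ℤ → (⨁ i, A i) →ₗ[K] Module.End K (Fock Φ)} {vac : Fock Φ}

variable {N : ℕ}

/-- The number of letters of part `k` in an index word. -/
def partCount (k : ℕ) (L : List (Lex (Fin N × ℕ))) : ℕ := L.countP fun σ ↦ decide (letterPart σ = k)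

omit [Field K] in
/-- The empty word has no letters of part `k`. -/
@[simp] theorem partCount_nil (k : ℕ) : partCount k ([] : List (Lex (Fin N × ℕ))) = 0 := rfl

omit [Field K] in
/-- Counting the letters of part `k` of a cons. -/
theorem partCount_cons (k : ℕ) (σ : Lex (Fin N × ℕ)) (L : List (Lex (Fin N × ℕ))) :
    partCount k (σ :: L) = partCount k L + if letterPart σ = k then 1 else 0 := by
  simp only [partCount, List.countP_cons, decide_eq_true_eq]

/-- **(N1) on words.**  For an even Casimir tensor `C` of a graded-symmetric pairing, `τ_k(id)` (`k ≥ 1`) acts on the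
creation monomial of an index word with homogeneous letters `x_c ∈ A_{deg c}` and parts `≥ 1` by the scalar
`−k · #{letters of part k}`. -/
theorem transferTerm_id_monomialOp_vac (h : IsHeisenbergRepresentation B q vac)
    (hB : ∀ (i j : ℕ) (a : A i) (b : A j),
      B (lof K ℕ A i a) (lof K ℕ A j b) = (-1 : K) ^ (i * j) * B (lof K ℕ A j b) (lof K ℕ A i a))
    {C : (⨁ i, A i) ⊗[K] (⨁ i, A i)} (hCg : C ∈ evenTensorSpan K A) (hC : IsCasimir K B C)
    {x : Fin N → ⨁ i, A i} {deg : Fin N → ℕ} (hx : ∀ c, x c ∈ LinearMap.range (lof K ℕ A (deg c)))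
    {k : ℕ} (hk : 1 ≤ k) (L : List (Lex (Fin N × ℕ))) (hL : ∀ σ ∈ L, 1 ≤ letterPart σ) :
    transferTerm K q C LinearMap.id (k : ℤ) (monomialOp q (letterWord x L) vac) =
      (-((k : K) * (partCount k L : ℕ))) • monomialOp q (letterWord x L) vac := by
  induction L with
  | nil =>
    rw [letterWord_nil, monomialOp_nil, Module.End.one_apply, Join.transferTerm_vac h C _ (by omega), partCount_nil,
      Nat.cast_zero, mul_zero, neg_zero, zero_smul]
  | cons σ L ih =>
    have hL' : ∀ τ ∈ L, 1 ≤ letterPart τ := fun τ hτ ↦ hL τ (List.mem_cons_of_mem σ hτ)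
    have hσ : 1 ≤ letterPart σ := hL σ List.mem_cons_self
    obtain ⟨γ, hγ⟩ := hx (letterColour σ)
    rw [letterWord_cons, monomialOp_cons, Module.End.mul_apply, ← hγ]
    -- the letter rule with `φ = id` (parity `0`): `τ_k(𝔮_m(γ) y) = 𝔮_m(γ)(τ_k y) − δ_{k,m} m 𝔮_m(γ) y`
    have hid : ∀ (j : ℕ) (ε : A j), (LinearMap.id : (⨁ i, A i) →ₗ[K] ⨁ i, A i) (lof K ℕ A j ε) ∈
        paritySpan K A (j + 0) := fun j ε ↦ lof_mem_paritySpan (by simp) ε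
    have key := SuperLie.transferTerm_superCommute_apply h hB hCg (p := 0) hid (n := (k : ℤ)) (m := (letterPart σ : ℤ))
      (by exact_mod_cast hk) (by exact_mod_cast hσ) γ (monomialOp q (letterWord x L) vac)
    rw [zero_mul, pow_zero, one_smul, hC (lof K ℕ A (deg (letterColour σ)) γ), LinearMap.id_apply] at key
    rw [sub_eq_iff_eq_add.mp key, ih hL', map_smul, partCount_cons, Nat.cast_add]
    by_cases hkm : letterPart σ = k
    · rw [if_pos (by exact_mod_cast hkm.symm), if_pos hkm, hkm, Nat.cast_one]
      module
    · rw [if_neg (by exact_mod_cast (Ne.symm hkm)), if_neg hkm, Nat.cast_zero, zero_add, add_zero]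

omit [Field K] in
/-- The letters of part `k` of the canonical word of `ρ` number `Σ_c ρ c k` (`= SF.shapeOf ρ k`). -/
theorem partCount_canonList {n : ℕ} (ρ : Fin N → Fin (n + 1) → ℕ) {k : ℕ} (hkn : k ≤ n) :
    partCount k (canonList n ρ) = shapeOf ρ ⟨k, Nat.lt_succ_of_le hkn⟩ := by
  classical
  simp only [partCount, canonList, List.countP_flatMap, Function.comp_def, List.countP_replicate, letterPart_toLex,
    decide_eq_true_eq, shapeOf]
  rw [← Fin.sum_univ_def]
  refine Finset.sum_congr rfl fun c _ ↦ ?_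
  rw [← Fin.sum_univ_def,
    Finset.sum_eq_single ⟨k, Nat.lt_succ_of_le hkn⟩ (fun r _ hr ↦ if_neg fun h ↦ hr (Fin.ext h)) (by simp), if_pos rfl]

end Words

/-! ### N1 on the tree's carriers: `τ_k(id)|ₙ` is diagonal in the Nakajima monomial basis -/

variable {S : SchemeOver ℂ} {hS : IsSmoothProjective 2 S} {H : HilbertSchemesOfPoints S}

/-- **(N1)** `τ_k(id)|ₙ` acts on the Nakajima monomial of `ρ` by `−k · (shapeOf ρ k)` (the number of parts of length `k`,
all colours). -/
theorem twoPt_id_monBasis (𝔑 : NakajimaOperators hS H)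
    (C : totalCohomology ℂ (ComplexPoints S) ⊗[ℂ] totalCohomology ℂ (ComplexPoints S))
    (hCg : C ∈ evenTensorSpan ℂ (coeffFamily S)) (hC : IsCasimir ℂ (poincarePairing hS) C)
    {ι : Type} [Fintype ι] (b : Module.Basis ι ℂ (totalCohomology ℂ (ComplexPoints S))) (deg : ι → ℕ)
    (hb : ∀ i, b i ∈ LinearMap.range (ofDegree ℂ (ComplexPoints S) (deg i))) (n : ℕ)
    (ρ : {ρ : Fin (Fintype.card ι) → Fin (n + 1) → ℕ // IsPartitionValued (deg ∘ (Fintype.equivFin ι).symm) n ρ})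
    (k : ℕ) (hk : 1 ≤ k) (hkn : k ≤ n) :
    twoPt 𝔑 C LinearMap.id k n (monBasis 𝔑 b deg hb n ρ) =
      (-((k : ℂ) * (shapeOf ρ.1 ⟨k, Nat.lt_succ_of_le hkn⟩ : ℕ))) • monBasis 𝔑 b deg hb n ρ := by
  have happly : Fock.ofSummand ℂ (fockFamily H) n (monBasis 𝔑 b deg hb n ρ) =
      monomialOp 𝔑.q (letterWord (⇑b ∘ (Fintype.equivFin ι).symm) (canonList n ρ.1)) (vacuumVector H) := by
    rw [monBasis, NakajimaOperators.heisenbergMonomialBasisSummand_apply, heisenbergMonomial, ← letterWord_canonList]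
  have hword := transferTerm_id_monomialOp_vac 𝔑.isHeisenberg (poincarePairing_graded_symm hS) hCg hC
    (x := ⇑b ∘ (Fintype.equivFin ι).symm) (deg := deg ∘ (Fintype.equivFin ι).symm) (fun c ↦ hb _) hk (canonList n ρ.1)
    (isAdmissibleWord_canonList ρ.2).1
  rw [partCount_canonList ρ.1 hkn] at hword
  rw [twoPt, restrictFock, LinearMap.comp_apply, LinearMap.comp_apply, happly, hword, map_smul, ← happly]
  congr 1
  exact DirectSum.component.lof_self _ _ _


/-! ### N2: eigen-separation (generic linear algebra) -/

section EigenSeparation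

variable {ι σ M κ : Type*} [AddCommGroup M] [Module ℂ M]

/-- The `P`-piece of `u` in the basis `B`: the part of the expansion of `u` on the basis vectors `B i` with `P i`. -/
def piece (B : Module.Basis ι ℂ M) (P : ι → Prop) [DecidablePred P] (u : M) : M :=
  Finsupp.linearCombination ℂ B ((B.repr u).filter P)

/-- The piece as an explicit sum over the support. -/
theorem piece_eq_sum (B : Module.Basis ι ℂ M) (P : ι → Prop) [DecidablePred P] (u : M) :
    piece B P u = ∑ i ∈ (B.repr u).support with P i, B.repr u i • B i := by
  rw [piece, Finsupp.linearCombination_apply, Finsupp.sum, Finsupp.support_filter]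
  refine Finset.sum_congr rfl fun i hi ↦ ?_
  rw [Finset.mem_filter] at hi
  rw [Finsupp.filter_apply_pos _ _ hi.2]

/-- The basis coordinates of a piece. -/
theorem repr_piece (B : Module.Basis ι ℂ M) (P : ι → Prop) [DecidablePred P] (u : M) :
    B.repr (piece B P u) = (B.repr u).filter P := by
  rw [piece, B.repr_linearCombination]

/-- A piece of a piece is the piece for the conjunction. -/
theorem piece_piece (B : Module.Basis ι ℂ M) (P Q : ι → Prop) [DecidablePred P] [DecidablePred Q] (u : M) :
    piece B Q (piece B P u) = piece B (fun i ↦ P i ∧ Q i) u := by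
  rw [piece, repr_piece, piece]
  congr 1
  ext i
  simp only [Finsupp.filter_apply]
  by_cases hP : P i <;> by_cases hQ : Q i <;> simp [hP, hQ]

/-- The piece for a predicate holding on the whole support is the vector itself. -/
theorem piece_eq_self (B : Module.Basis ι ℂ M) (P : ι → Prop) [DecidablePred P] (u : M)
    (h : ∀ i ∈ (B.repr u).support, P i) : piece B P u = u := by
  conv_rhs => rw [← B.linearCombination_repr u]
  rw [piece]
  congr 1
  ext i
  rw [Finsupp.filter_apply]
  by_cases hi : i ∈ (B.repr u).support
  · rw [if_pos (h i hi)]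
  · rw [Finsupp.notMem_support_iff.mp hi]; simp

/-- Pieces for predicates agreeing on the support coincide. -/
theorem piece_congr (B : Module.Basis ι ℂ M) (P Q : ι → Prop) [DecidablePred P] [DecidablePred Q] (u : M)
    (h : ∀ i ∈ (B.repr u).support, (P i ↔ Q i)) : piece B P u = piece B Q u := by
  rw [piece, piece]
  congr 1
  ext i
  rw [Finsupp.filter_apply, Finsupp.filter_apply]
  by_cases hi : i ∈ (B.repr u).support
  · simp only [h i hi]
  · rw [Finsupp.notMem_support_iff.mp hi]; simp

/-- **One diagonal operator**: if `T` is diagonal in the basis `B` with eigenvalues `e i` and `W` is `T`-stable, then `W`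
contains the `e = μ` eigen-piece of each of its vectors (Lagrange interpolation over the finitely many eigenvalues met,
`L1Hilb.mem_of_vandermonde`). -/
theorem piece_eigen_mem (B : Module.Basis ι ℂ M) (W : Submodule ℂ M) (T : Module.End ℂ M) (e : ι → ℂ)
    (hdiag : ∀ i, T (B i) = e i • B i) (hW : ∀ w ∈ W, T w ∈ W) {u : M} (hu : u ∈ W) (μ : ℂ) :
    piece B (fun i ↦ e i = μ) u ∈ W := by
  classical
  -- powers of `T` on `u`
  have hpowB : ∀ (m : ℕ) (i : ι), (T ^ m) (B i) = (e i) ^ m • B i := by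
    intro m i
    induction m with
    | zero => simp
    | succ m ih => rw [pow_succ, Module.End.mul_apply, hdiag, map_smul, ih, smul_smul, ← pow_succ']
  have hpowW : ∀ m : ℕ, (T ^ m) u ∈ W := by
    intro m
    induction m with
    | zero => simpa using hu
    | succ m ih => rw [pow_succ', Module.End.mul_apply]; exact hW _ ih
  have hsum : ∀ m : ℕ, ∑ μ' ∈ (B.repr u).support.image e, μ' ^ m • piece B (fun i ↦ e i = μ') u = (T ^ m) u := by
    intro m
    conv_rhs => rw [← B.linearCombination_repr u, Finsupp.linearCombination_apply, Finsupp.sum, map_sum]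
    simp only [map_smul, hpowB, piece_eq_sum, Finset.smul_sum, smul_smul]
    rw [← Finset.sum_fiberwise_of_maps_to (s := (B.repr u).support) (t := (B.repr u).support.image e) (g := e)
      (fun i hi ↦ Finset.mem_image_of_mem e hi)]
    refine Finset.sum_congr rfl fun μ' _ ↦ Finset.sum_congr rfl fun i hi ↦ ?_
    rw [Finset.mem_filter] at hi
    rw [← hi.2, mul_comm]
  by_cases hμ : μ ∈ (B.repr u).support.image e
  · exact Eval.mem_of_vandermonde W _ id (Set.injOn_id _) (fun μ' ↦ piece B (fun i ↦ e i = μ') u)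
      (fun m _ ↦ by simpa using (hsum m ▸ hpowW m :
        ∑ μ' ∈ (B.repr u).support.image e, id μ' ^ m • piece B (fun i ↦ e i = μ') u ∈ W)) hμ
  · -- no basis vector in the support has eigenvalue `μ`: the piece is `0`
    have : piece B (fun i ↦ e i = μ) u = 0 := by
      rw [piece_eq_sum]
      refine Finset.sum_eq_zero fun i hi ↦ ?_
      rw [Finset.mem_filter] at hi
      exact (hμ (hi.2 ▸ Finset.mem_image_of_mem e hi.1)).elim
    rw [this]
    exact W.zero_mem

/-- **(N2) Eigen-separation.**  A subspace stable under a family of operators that are simultaneously diagonal in a basis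
`B`, with eigenvalues depending only on `shape` and separating shapes, is shape-graded: it contains the shape-isotypic
pieces of its vectors (refine by one operator at a time). -/
theorem shapeGraded_of_diag [DecidableEq σ] (B : Module.Basis ι ℂ M) (shape : ι → σ) (W : Submodule ℂ M)
    (T : κ → Module.End ℂ M) (ev : κ → σ → ℂ) (hdiag : ∀ k i, T k (B i) = ev k (shape i) • B i)
    (hsep : ∀ i j, shape i ≠ shape j → ∃ k, ev k (shape i) ≠ ev k (shape j)) (hW : ∀ k, ∀ w ∈ W, T k w ∈ W) :
    ShapeGraded B shape W := by
  classical
  intro w hw s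
  rw [← piece_eq_sum]
  -- refining by a list of operators keeps us in `W`
  have hrefine : ∀ L : List κ, piece B (fun i ↦ ∀ k ∈ L, ev k (shape i) = ev k s) w ∈ W := by
    intro L
    induction L with
    | nil => rw [piece_eq_self B _ w (fun i _ k hk ↦ (List.not_mem_nil hk).elim)]; exact hw
    | cons k L ih =>
      have hstep := piece_eigen_mem B W (T k) (fun i ↦ ev k (shape i)) (hdiag k) (hW k) ih (ev k s)
      rw [piece_piece] at hstep
      rw [piece_congr B _ (fun i ↦ (∀ k' ∈ L, ev k' (shape i) = ev k' s) ∧ ev k (shape i) = ev k s) w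
        (fun i _ ↦ by simp only [List.forall_mem_cons]; tauto)]
      exact hstep
  by_cases hs : ∃ j, shape j = s
  · obtain ⟨j₀, hj₀⟩ := hs
    -- one separating operator for each support index of a different shape
    let L : List κ := ((B.repr w).support.toList).filterMap fun i ↦
      if h : shape i ≠ shape j₀ then some (Classical.choose (hsep i j₀ h)) else none
    rw [piece_congr B (fun i ↦ shape i = s) (fun i ↦ ∀ k ∈ L, ev k (shape i) = ev k s) w ?_]
    · exact hrefine L
    · intro i hi
      constructor
      · intro his k _; rw [his]
      · intro hall
        by_contra hne
        have hne' : shape i ≠ shape j₀ := by rwa [hj₀]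
        have hmem : Classical.choose (hsep i j₀ hne') ∈ L := by
          simp only [L, List.mem_filterMap, Finset.mem_toList]
          exact ⟨i, hi, by rw [dif_pos hne']⟩
        have := hall _ hmem
        rw [← hj₀] at this
        exact Classical.choose_spec (hsep i j₀ hne') this
  · -- no index has shape `s`: the piece is empty
    have : piece B (fun i ↦ shape i = s) w = 0 := by
      rw [piece_eq_sum]
      refine Finset.sum_eq_zero fun i hi ↦ ?_
      rw [Finset.mem_filter] at hi
      exact (hs ⟨i, hi.2⟩).elim
    rw [this]
    exact W.zero_mem

end EigenSeparation

/-! ### The NUMBER half -/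

/-- **`SF.NumberHalf` (p1 g5's half of S-F)**: stability under the number operators `τ_k(id)|ₙ`, `1 ≤ k ≤ n`, makes `W`
shape-graded in the Nakajima monomial basis — plan g19's composition of (N1) `twoPt_id_monBasis` and (N2)
`shapeGraded_of_diag` (the eigenvalue vectors `(−k · shapeOf ρ k)_k` separate shapes since `shapeOf ρ 0 = 0`). -/
theorem numberHalf : NumberHalf := by
  intro S hS H 𝔑 C hCg hC ι _ _ b deg hb n W hN
  refine shapeGraded_of_diag (monBasis 𝔑 b deg hb n) (fun ρ ↦ shapeOf ρ.1) W
    (κ := {k : ℕ // 1 ≤ k ∧ k ≤ n}) (fun k ↦ twoPt 𝔑 C LinearMap.id k.1 n)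
    (fun k s ↦ -((k.1 : ℂ) * (s ⟨k.1, Nat.lt_succ_of_le k.2.2⟩ : ℕ))) ?_ ?_ ?_
  · intro k ρ
    exact twoPt_id_monBasis 𝔑 C hCg hC b deg hb n ρ k.1 k.2.1 k.2.2
  · intro ρ ρ' hne
    obtain ⟨r, hr⟩ := Function.ne_iff.mp hne
    have hr0 : (r : ℕ) ≠ 0 := by
      intro h0
      have h0' : r = 0 := Fin.ext h0
      subst h0'
      exact hr (by simp [shapeOf, ρ.2.1, ρ'.2.1])
    refine ⟨⟨r, Nat.one_le_iff_ne_zero.mpr hr0, by omega⟩, ?_⟩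
    have hr' : (⟨(r : ℕ), Nat.lt_succ_of_le (by omega : (r : ℕ) ≤ n)⟩ : Fin (n + 1)) = r := Fin.ext rfl
    intro h
    apply hr
    rw [hr'] at h
    have hk : ((r : ℕ) : ℂ) ≠ 0 := by exact_mod_cast hr0
    have h' := mul_left_cancel₀ hk (neg_injective h)
    exact_mod_cast h'
  · intro k w hw
    exact hN k.1 k.2.1 k.2.2 w hw

end Summit.Ventures.HodgeKum4.L1Hilb.SF

end
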